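import Summits.AnomalousDissipation.AnomalousDissipation.Theorems.SolenoidalFractalHomogenisationLagrangianStepCellLawVQSOddEvenForced
import HarnessLib

/-!
# K1L `LagrangianRenormalisationStep(Design)` (K1L_D, stmt-AnomalousDissipation-27980), stub `stub_cellLawV0_IS`, IS-half obligation
# `stub_W_evenSlackB`, analytic stub S2 «odd/even comparison» — PART 2/3: the three orbits and the KERNEL COMPARISON
# `|vᵀe^{−τB}v − vᵀe^{−τB_s}v| ≤ (ω²/2)τ²e^{−bτ}|v|²` (helper; `--supports … --as helper`; word-independent)

Summits-side helper file of route `SolenoidalFractalHomogenisation` (prover seat `ad-sawtooth-k1loc-p1` g12; planner ad-ideate-p5 g12's even certificate,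
v2 cut, stub S2).  For an arbitrary real block `B` with `b|w|² ≤ wᵀBw` and `(uᵀBw − wᵀBu)² ≤ 4ω²|u|²|w|²`: with `u = e^{−tB}v`, `ū = e^{−tBᵀ}v`,
`z = e^{−tB_s}v`, `B_s = ½(B + Bᵀ)` — `hasDerivAt_orbit_differences` (`(u − z)' = −B_s(u − z) − ½(B − Bᵀ)u`, `(ū − z)' = −B_s(ū − z) + ½(B − Bᵀ)ū`,
`(u + ū − 2z)' = −B_s(u + ū − 2z) − ½(B − Bᵀ)(u − ū)`), `sqrt_sum_sq_orbit_le` (`|u|, |ū|, |z| ≤ e^{−bt}|v|`), `sqrt_sum_sq_orbit_sub_le`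
(`|u − z|, |ū − z| ≤ |ω| t e^{−bt}|v|`), `sqrt_sum_sq_orbit_second_le` (`|u + ū − 2z| ≤ ω²t²e^{−bt}|v|`), the half-time split `form_exp_two_mul_eq`
(`vᵀe^{−2tB}v = ⟨ū, u⟩`, `Matrix.exp_add_of_commute` + `exp_transpose`) and **`abs_form_exp_sub_form_exp_symm_le`**:
`|vᵀe^{−τB}v − vᵀe^{−τB_s}v| = |⟨ū − z, u − z⟩ + ⟨z, u + ū − 2z⟩| ≤ (ω²/2)·τ²·e^{−bτ}·|v|²` (`τ ≥ 0`) — second order in the skew part, the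
first-order term having zero quadratic form.  Everything PROVED, no definition, no named fact, no sorry.  Infrastructure for rung leaf F-D1.A0; NOT a
proof of the stub, of the crux, of Onsager's conjecture or of anomalous dissipation.
-/

set_option linter.dupNamespace false

noncomputable section

namespace Summit.AnomalousDissipation.AnomalousDissipation.Theorems.SolenoidalFractalHomogenisation.LagrangianStep

open Literature.Analysis Literature.Analysis.FluidPDE Literature.Analysis.FunctionSpaces
open Literature.Analysis.ODE.PeriodicAveraging
open MeasureTheory Set Real Matrix

/-! ## §3 The three orbits `u = e^{−tB}v`, `ū = e^{−tBᵀ}v`, `z = e^{−tB_s}v` and their forced differences -/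

section Orbits

variable {m : ℕ}
variable (B : Matrix (Fin m) (Fin m) ℝ) (v : Fin m → ℝ)

/-- **The forced equations.**  `d = u − z` solves `d' = −B_s d − ½(B − Bᵀ)u`; `d̄ = ū − z` solves `d̄' = −B_s d̄ + ½(B − Bᵀ)ū`;
`s = u + ū − 2z` solves `s' = −B_s s − ½(B − Bᵀ)(u − ū)`. [folklore] -/
theorem hasDerivAt_orbit_differences (t : ℝ) :
    HasDerivAt (fun s : ℝ => (NormedSpace.exp (-(s • B))).mulVec v - (NormedSpace.exp (-(s • ((1 / 2 : ℝ) • (B + Bᵀ))))).mulVec v)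
      (-(((1 / 2 : ℝ) • (B + Bᵀ)).mulVec ((NormedSpace.exp (-(t • B))).mulVec v
          - (NormedSpace.exp (-(t • ((1 / 2 : ℝ) • (B + Bᵀ))))).mulVec v))
        + -((1 / 2 : ℝ) • ((B - Bᵀ).mulVec ((NormedSpace.exp (-(t • B))).mulVec v)))) t ∧
    HasDerivAt (fun s : ℝ => (NormedSpace.exp (-(s • Bᵀ))).mulVec v - (NormedSpace.exp (-(s • ((1 / 2 : ℝ) • (B + Bᵀ))))).mulVec v)
      (-(((1 / 2 : ℝ) • (B + Bᵀ)).mulVec ((NormedSpace.exp (-(t • Bᵀ))).mulVec v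
          - (NormedSpace.exp (-(t • ((1 / 2 : ℝ) • (B + Bᵀ))))).mulVec v))
        + (1 / 2 : ℝ) • ((B - Bᵀ).mulVec ((NormedSpace.exp (-(t • Bᵀ))).mulVec v))) t ∧
    HasDerivAt (fun s : ℝ => (NormedSpace.exp (-(s • B))).mulVec v + (NormedSpace.exp (-(s • Bᵀ))).mulVec v
        - (2:ℝ) • (NormedSpace.exp (-(s • ((1 / 2 : ℝ) • (B + Bᵀ))))).mulVec v)
      (-(((1 / 2 : ℝ) • (B + Bᵀ)).mulVec ((NormedSpace.exp (-(t • B))).mulVec v + (NormedSpace.exp (-(t • Bᵀ))).mulVec v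
          - (2:ℝ) • (NormedSpace.exp (-(t • ((1 / 2 : ℝ) • (B + Bᵀ))))).mulVec v))
        + -((1 / 2 : ℝ) • ((B - Bᵀ).mulVec ((NormedSpace.exp (-(t • B))).mulVec v
            - (NormedSpace.exp (-(t • Bᵀ))).mulVec v)))) t := by
  have hu := hasDerivAt_exp_neg_smul_mulVec B v t
  have hub := hasDerivAt_exp_neg_smul_mulVec Bᵀ v t
  have hz := hasDerivAt_exp_neg_smul_mulVec ((1 / 2 : ℝ) • (B + Bᵀ)) v t
  refine ⟨?_, ?_, ?_⟩
  · refine (hu.sub hz).congr_deriv ?_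
    simp only [Matrix.smul_mulVec, Matrix.add_mulVec, Matrix.sub_mulVec, Matrix.mulVec_sub]
    module
  · refine (hub.sub hz).congr_deriv ?_
    simp only [Matrix.smul_mulVec, Matrix.add_mulVec, Matrix.sub_mulVec, Matrix.mulVec_sub]
    module
  · refine ((hu.add hub).sub (hz.const_smul (2:ℝ))).congr_deriv ?_
    simp only [Matrix.smul_mulVec, Matrix.add_mulVec, Matrix.sub_mulVec, Matrix.mulVec_add, Matrix.mulVec_sub,
      Matrix.mulVec_smul]
    module

/-- **Orbit decay** (no symmetry): `b|w|² ≤ wᵀBw` ⟹ `|e^{−tB}v|, |e^{−tBᵀ}v|, |e^{−tB_s}v| ≤ e^{−bt}|v|` (`t ≥ 0`). [folklore] -/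
theorem sqrt_sum_sq_orbit_le {b : ℝ} (hb : ∀ w : Fin m → ℝ, b * ∑ i, w i ^ 2 ≤ ∑ i, ∑ j, w i * B i j * w j)
    {t : ℝ} (ht : 0 ≤ t) :
    Real.sqrt (∑ i, ((NormedSpace.exp (-(t • B))).mulVec v i) ^ 2) ≤ Real.exp (-(b * t)) * Real.sqrt (∑ i, v i ^ 2) ∧
    Real.sqrt (∑ i, ((NormedSpace.exp (-(t • Bᵀ))).mulVec v i) ^ 2) ≤ Real.exp (-(b * t)) * Real.sqrt (∑ i, v i ^ 2) ∧
    Real.sqrt (∑ i, ((NormedSpace.exp (-(t • ((1 / 2 : ℝ) • (B + Bᵀ))))).mulVec v i) ^ 2)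
      ≤ Real.exp (-(b * t)) * Real.sqrt (∑ i, v i ^ 2) := by
  have key : ∀ C : Matrix (Fin m) (Fin m) ℝ, (∀ w : Fin m → ℝ, b * ∑ i, w i ^ 2 ≤ ∑ i, ∑ j, w i * C i j * w j) →
      Real.sqrt (∑ i, ((NormedSpace.exp (-(t • C))).mulVec v i) ^ 2) ≤ Real.exp (-(b * t)) * Real.sqrt (∑ i, v i ^ 2) := by
    intro C hC
    have h := sum_sq_exp_neg_smul_mulVec_le C hC v ht
    have he : Real.exp (-(2 * b * t)) = Real.exp (-(b * t)) ^ 2 := by rw [← Real.exp_nat_mul]; ring_nf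
    rw [he, ← Real.sq_sqrt (Finset.sum_nonneg fun i _ => sq_nonneg (v i)), ← mul_pow] at h
    exact Real.sqrt_le_iff.2 ⟨mul_nonneg (Real.exp_pos _).le (Real.sqrt_nonneg _), h⟩
  refine ⟨key B hb, key Bᵀ fun w => ?_, key _ fun w => ?_⟩
  · rw [quad_transpose]; exact hb w
  · rw [quad_symmPart]; exact hb w

/-- **First-order differences**: `|u − z|, |ū − z| ≤ |ω| t e^{−bt} |v|` for `t ≥ 0`. [folklore] -/
theorem sqrt_sum_sq_orbit_sub_le {b ω : ℝ} (hb : ∀ w : Fin m → ℝ, b * ∑ i, w i ^ 2 ≤ ∑ i, ∑ j, w i * B i j * w j)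
    (hω : ∀ u w : Fin m → ℝ, (∑ i, ∑ j, u i * B i j * w j - ∑ i, ∑ j, w i * B i j * u j) ^ 2
      ≤ 4 * ω ^ 2 * (∑ i, u i ^ 2) * (∑ i, w i ^ 2)) {t : ℝ} (ht : 0 ≤ t) :
    Real.sqrt (∑ i, ((NormedSpace.exp (-(t • B))).mulVec v i - (NormedSpace.exp (-(t • ((1 / 2 : ℝ) • (B + Bᵀ))))).mulVec v i) ^ 2)
      ≤ Real.exp (-(b * t)) * (|ω| * Real.sqrt (∑ i, v i ^ 2) * t) ∧
    Real.sqrt (∑ i, ((NormedSpace.exp (-(t • Bᵀ))).mulVec v i - (NormedSpace.exp (-(t • ((1 / 2 : ℝ) • (B + Bᵀ))))).mulVec v i) ^ 2)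
      ≤ Real.exp (-(b * t)) * (|ω| * Real.sqrt (∑ i, v i ^ 2) * t) := by
  set Bs := (1 / 2 : ℝ) • (B + Bᵀ) with hBs
  set K := Real.sqrt (∑ i, v i ^ 2) with hK
  have hBs' : ∀ w : Fin m → ℝ, b * ∑ i, w i ^ 2 ≤ ∑ i, ∑ j, w i * Bs i j * w j := fun w => by
    rw [hBs, quad_symmPart]; exact hb w
  have hG : ∀ s, HasDerivAt (fun s => |ω| * K * s) (|ω| * K) s := fun s => by
    simpa using (hasDerivAt_id s).const_mul (|ω| * K)
  -- the forcing bound `e^{bs} |½(B−Bᵀ) y(s)| ≤ |ω| K` for an orbit `y` with `|y(s)| ≤ e^{−bs} K`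
  have hforce : ∀ (C : Matrix (Fin m) (Fin m) ℝ), (∀ w : Fin m → ℝ, b * ∑ i, w i ^ 2 ≤ ∑ i, ∑ j, w i * C i j * w j) →
      ∀ (σ : ℝ) (s : ℝ), 0 ≤ s →
      Real.exp (b * s) * Real.sqrt (∑ i, (σ • ((1 / 2 : ℝ) • ((B - Bᵀ).mulVec ((NormedSpace.exp (-(s • C))).mulVec v)))) i ^ 2)
        ≤ |ω| * K * |σ| := by
    intro C hC σ s hs
    set y := (NormedSpace.exp (-(s • C))).mulVec v with hy
    have hy1 : Real.sqrt (∑ i, y i ^ 2) ≤ Real.exp (-(b * s)) * K := by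
      have h := sum_sq_exp_neg_smul_mulVec_le C hC v hs
      have he : Real.exp (-(2 * b * s)) = Real.exp (-(b * s)) ^ 2 := by rw [← Real.exp_nat_mul]; ring_nf
      rw [he, ← Real.sq_sqrt (Finset.sum_nonneg fun i _ => sq_nonneg (v i)), ← mul_pow] at h
      exact Real.sqrt_le_iff.2 ⟨mul_nonneg (Real.exp_pos _).le (Real.sqrt_nonneg _), h⟩
    have hskew := sum_sq_skew_mulVec_le B hω y
    have e1 : ∑ i, (σ • ((1 / 2 : ℝ) • ((B - Bᵀ).mulVec y))) i ^ 2 = (σ / 2) ^ 2 * ∑ i, ((B - Bᵀ).mulVec y i) ^ 2 := by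
      simp only [Pi.smul_apply, smul_eq_mul, Finset.mul_sum]
      exact Finset.sum_congr rfl fun i _ => by ring
    rw [e1, Real.sqrt_mul (sq_nonneg _), Real.sqrt_sq_eq_abs]
    have h2 : Real.sqrt (∑ i, ((B - Bᵀ).mulVec y i) ^ 2) ≤ 2 * |ω| * Real.sqrt (∑ i, y i ^ 2) := by
      have e2 : 4 * ω ^ 2 * ∑ i, y i ^ 2 = (2 * |ω| * Real.sqrt (∑ i, y i ^ 2)) ^ 2 := by
        rw [mul_pow, mul_pow, sq_abs, Real.sq_sqrt (Finset.sum_nonneg fun i _ => sq_nonneg _)]; ring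
      rw [e2] at hskew
      exact Real.sqrt_le_iff.2 ⟨by positivity, hskew⟩
    have hexp : Real.exp (b * s) * Real.exp (-(b * s)) = 1 := by rw [← Real.exp_add]; simp
    have h3 : Real.exp (b * s) * Real.sqrt (∑ i, y i ^ 2) ≤ K := by
      calc Real.exp (b * s) * Real.sqrt (∑ i, y i ^ 2) ≤ Real.exp (b * s) * (Real.exp (-(b * s)) * K) :=
            mul_le_mul_of_nonneg_left hy1 (Real.exp_pos _).le
        _ = K := by rw [← mul_assoc, hexp, one_mul]
    have habs : |σ / 2| = |σ| / 2 := by rw [abs_div, abs_two]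
    rw [habs]
    calc Real.exp (b * s) * (|σ| / 2 * Real.sqrt (∑ i, ((B - Bᵀ).mulVec y i) ^ 2))
        = |σ| / 2 * (Real.exp (b * s) * Real.sqrt (∑ i, ((B - Bᵀ).mulVec y i) ^ 2)) := by ring
      _ ≤ |σ| / 2 * (Real.exp (b * s) * (2 * |ω| * Real.sqrt (∑ i, y i ^ 2))) :=
          mul_le_mul_of_nonneg_left (mul_le_mul_of_nonneg_left h2 (Real.exp_pos _).le) (by positivity)
      _ = |σ| * |ω| * (Real.exp (b * s) * Real.sqrt (∑ i, y i ^ 2)) := by ring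
      _ ≤ |σ| * |ω| * K := mul_le_mul_of_nonneg_left h3 (by positivity)
      _ = |ω| * K * |σ| := by ring
  constructor
  · -- `d = u − z`, forcing `−½(B−Bᵀ)u = (−1)•(½(B−Bᵀ)u)`
    have hder := fun s => (hasDerivAt_orbit_differences B v s).1
    have h := forced_energy_bound Bs hBs'
      (fun s => (NormedSpace.exp (-(s • B))).mulVec v - (NormedSpace.exp (-(s • Bs))).mulVec v)
      (fun s => -((1 / 2 : ℝ) • ((B - Bᵀ).mulVec ((NormedSpace.exp (-(s • B))).mulVec v))))
      hder (by simp) (fun s => |ω| * K * s) (fun _ => |ω| * K) hG (by simp) ?_ ht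
    · simpa only [Pi.sub_apply] using h
    · intro s hs
      have h1 := hforce B hb (-1) s hs
      simp only [neg_smul, one_smul, abs_neg, abs_one, mul_one] at h1
      exact h1
  · have hder := fun s => (hasDerivAt_orbit_differences B v s).2.1
    have hbT : ∀ w : Fin m → ℝ, b * ∑ i, w i ^ 2 ≤ ∑ i, ∑ j, w i * Bᵀ i j * w j := fun w => by
      rw [quad_transpose]; exact hb w
    have h := forced_energy_bound Bs hBs'
      (fun s => (NormedSpace.exp (-(s • Bᵀ))).mulVec v - (NormedSpace.exp (-(s • Bs))).mulVec v)
      (fun s => (1 / 2 : ℝ) • ((B - Bᵀ).mulVec ((NormedSpace.exp (-(s • Bᵀ))).mulVec v)))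
      hder (by simp) (fun s => |ω| * K * s) (fun _ => |ω| * K) hG (by simp) ?_ ht
    · simpa only [Pi.sub_apply] using h
    · intro s hs
      have h1 := hforce Bᵀ hbT 1 s hs
      simp only [one_smul, abs_one, mul_one] at h1
      exact h1

/-- **Second-order combination**: `|u + ū − 2z| ≤ ω² t² e^{−bt} |v|` for `t ≥ 0`. [folklore] -/
theorem sqrt_sum_sq_orbit_second_le {b ω : ℝ} (hb : ∀ w : Fin m → ℝ, b * ∑ i, w i ^ 2 ≤ ∑ i, ∑ j, w i * B i j * w j)
    (hω : ∀ u w : Fin m → ℝ, (∑ i, ∑ j, u i * B i j * w j - ∑ i, ∑ j, w i * B i j * u j) ^ 2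
      ≤ 4 * ω ^ 2 * (∑ i, u i ^ 2) * (∑ i, w i ^ 2)) {t : ℝ} (ht : 0 ≤ t) :
    Real.sqrt (∑ i, ((NormedSpace.exp (-(t • B))).mulVec v i + (NormedSpace.exp (-(t • Bᵀ))).mulVec v i
        - 2 * (NormedSpace.exp (-(t • ((1 / 2 : ℝ) • (B + Bᵀ))))).mulVec v i) ^ 2)
      ≤ Real.exp (-(b * t)) * (ω ^ 2 * Real.sqrt (∑ i, v i ^ 2) * t ^ 2) := by
  set Bs := (1 / 2 : ℝ) • (B + Bᵀ) with hBs
  set K := Real.sqrt (∑ i, v i ^ 2) with hK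
  have hBs' : ∀ w : Fin m → ℝ, b * ∑ i, w i ^ 2 ≤ ∑ i, ∑ j, w i * Bs i j * w j := fun w => by
    rw [hBs, quad_symmPart]; exact hb w
  have hG : ∀ s, HasDerivAt (fun s => ω ^ 2 * K * s ^ 2) (2 * ω ^ 2 * K * s) s := fun s => by
    have h := ((hasDerivAt_id s).fun_pow 2).const_mul (ω ^ 2 * K)
    refine h.congr_deriv ?_
    simp only [Nat.cast_ofNat, Nat.add_one_sub_one, pow_one, id]
    ring
  have hder := fun s => (hasDerivAt_orbit_differences B v s).2.2
  have h := forced_energy_bound Bs hBs'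
    (fun s => (NormedSpace.exp (-(s • B))).mulVec v + (NormedSpace.exp (-(s • Bᵀ))).mulVec v
      - (2:ℝ) • (NormedSpace.exp (-(s • Bs))).mulVec v)
    (fun s => -((1 / 2 : ℝ) • ((B - Bᵀ).mulVec ((NormedSpace.exp (-(s • B))).mulVec v
      - (NormedSpace.exp (-(s • Bᵀ))).mulVec v))))
    hder (by simp [two_smul]) (fun s => ω ^ 2 * K * s ^ 2) (fun s => 2 * ω ^ 2 * K * s) hG (by simp) ?_ ht
  · simpa only [Pi.sub_apply, Pi.add_apply, Pi.smul_apply, smul_eq_mul] using h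
  · intro s hs
    -- `|½(B−Bᵀ)(u−ū)| ≤ |ω|·|u − ū| ≤ |ω|(|u−z| + |z−ū|) ≤ 2ω² K s e^{−bs}`
    set y := (NormedSpace.exp (-(s • B))).mulVec v - (NormedSpace.exp (-(s • Bᵀ))).mulVec v with hy
    have hskew := sum_sq_skew_mulVec_le B hω y
    have e1 : ∑ i, (-((1 / 2 : ℝ) • ((B - Bᵀ).mulVec y))) i ^ 2 = (1 / 2) ^ 2 * ∑ i, ((B - Bᵀ).mulVec y i) ^ 2 := by
      simp only [Pi.neg_apply, Pi.smul_apply, smul_eq_mul, Finset.mul_sum]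
      exact Finset.sum_congr rfl fun i _ => by ring
    have h2 : Real.sqrt (∑ i, (-((1 / 2 : ℝ) • ((B - Bᵀ).mulVec y))) i ^ 2) ≤ |ω| * Real.sqrt (∑ i, y i ^ 2) := by
      rw [e1]
      refine Real.sqrt_le_iff.2 ⟨by positivity, ?_⟩
      rw [mul_pow, sq_abs, Real.sq_sqrt (Finset.sum_nonneg fun i _ => sq_nonneg _)]
      nlinarith
    obtain ⟨hd, hdb⟩ := sqrt_sum_sq_orbit_sub_le B v hb hω hs
    have hy' : Real.sqrt (∑ i, y i ^ 2) ≤ 2 * (Real.exp (-(b * s)) * (|ω| * K * s)) := by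
      have e2 : ∀ i, y i = ((NormedSpace.exp (-(s • B))).mulVec v i - (NormedSpace.exp (-(s • Bs))).mulVec v i)
          + -((NormedSpace.exp (-(s • Bᵀ))).mulVec v i - (NormedSpace.exp (-(s • Bs))).mulVec v i) := fun i => by
        rw [hy, Pi.sub_apply]; ring
      have h3 := sqrt_sum_sq_add_le
        (fun i => (NormedSpace.exp (-(s • B))).mulVec v i - (NormedSpace.exp (-(s • Bs))).mulVec v i)
        (fun i => -((NormedSpace.exp (-(s • Bᵀ))).mulVec v i - (NormedSpace.exp (-(s • Bs))).mulVec v i))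
      have e3 : ∑ i, y i ^ 2 = ∑ i, (((NormedSpace.exp (-(s • B))).mulVec v i - (NormedSpace.exp (-(s • Bs))).mulVec v i)
          + -((NormedSpace.exp (-(s • Bᵀ))).mulVec v i - (NormedSpace.exp (-(s • Bs))).mulVec v i)) ^ 2 :=
        Finset.sum_congr rfl fun i _ => by rw [e2 i]
      have e4 : ∑ i, (-((NormedSpace.exp (-(s • Bᵀ))).mulVec v i - (NormedSpace.exp (-(s • Bs))).mulVec v i)) ^ 2
          = ∑ i, ((NormedSpace.exp (-(s • Bᵀ))).mulVec v i - (NormedSpace.exp (-(s • Bs))).mulVec v i) ^ 2 :=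
        Finset.sum_congr rfl fun i _ => by ring
      rw [e3]
      rw [e4] at h3
      linarith
    have hexp : Real.exp (b * s) * Real.exp (-(b * s)) = 1 := by rw [← Real.exp_add]; simp
    calc Real.exp (b * s) * Real.sqrt (∑ i, (-((1 / 2 : ℝ) • ((B - Bᵀ).mulVec y))) i ^ 2)
        ≤ Real.exp (b * s) * (|ω| * Real.sqrt (∑ i, y i ^ 2)) := mul_le_mul_of_nonneg_left h2 (Real.exp_pos _).le
      _ ≤ Real.exp (b * s) * (|ω| * (2 * (Real.exp (-(b * s)) * (|ω| * K * s)))) :=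
          mul_le_mul_of_nonneg_left (mul_le_mul_of_nonneg_left hy' (abs_nonneg _)) (Real.exp_pos _).le
      _ = (Real.exp (b * s) * Real.exp (-(b * s))) * (2 * (|ω| * |ω|) * K * s) := by ring
      _ = 2 * ω ^ 2 * K * s := by rw [hexp, one_mul, ← sq, sq_abs]

end Orbits

/-! ## §4 The half-time split and the kernel comparison -/

section Kernel

variable {m : ℕ} (B : Matrix (Fin m) (Fin m) ℝ) (v : Fin m → ℝ)

/-- **Half-time split**: `vᵀ e^{−2tB} v = ⟨e^{−tBᵀ}v, e^{−tB}v⟩` (semigroup property and `(e^{−tB})ᵀ = e^{−tBᵀ}`). [folklore] -/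
theorem form_exp_two_mul_eq (t : ℝ) :
    ∑ i, v i * (NormedSpace.exp (-((2 * t) • B))).mulVec v i
      = ∑ i, (NormedSpace.exp (-(t • Bᵀ))).mulVec v i * (NormedSpace.exp (-(t • B))).mulVec v i := by
  have hsplit : NormedSpace.exp (-((2 * t) • B)) = NormedSpace.exp (-(t • B)) * NormedSpace.exp (-(t • B)) := by
    rw [← Matrix.exp_add_of_commute _ _ (Commute.refl _), ← neg_add, ← add_smul, two_mul]
  have htr : (NormedSpace.exp (-(t • B)))ᵀ = NormedSpace.exp (-(t • Bᵀ)) := by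
    rw [← Matrix.exp_transpose, Matrix.transpose_neg, Matrix.transpose_smul]
  rw [hsplit, ← Matrix.mulVec_mulVec]
  have h1 : ∑ i, v i * ((NormedSpace.exp (-(t • B))).mulVec ((NormedSpace.exp (-(t • B))).mulVec v)) i
      = v ⬝ᵥ ((NormedSpace.exp (-(t • B))).mulVec ((NormedSpace.exp (-(t • B))).mulVec v)) := rfl
  rw [h1, Matrix.dotProduct_mulVec, ← Matrix.mulVec_transpose, htr]
  rfl

/-- **Kernel comparison**: for `b|w|² ≤ wᵀBw` and the skew bound with `ω`, and every `τ ≥ 0`,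
`|vᵀ e^{−τB} v − vᵀ e^{−τB_s} v| ≤ (ω²/2)·τ²·e^{−bτ}·|v|²`, `B_s = ½(B + Bᵀ)`. [folklore] -/
theorem abs_form_exp_sub_form_exp_symm_le {b ω : ℝ} (hb : ∀ w : Fin m → ℝ, b * ∑ i, w i ^ 2 ≤ ∑ i, ∑ j, w i * B i j * w j)
    (hω : ∀ u w : Fin m → ℝ, (∑ i, ∑ j, u i * B i j * w j - ∑ i, ∑ j, w i * B i j * u j) ^ 2
      ≤ 4 * ω ^ 2 * (∑ i, u i ^ 2) * (∑ i, w i ^ 2)) {τ : ℝ} (hτ : 0 ≤ τ) :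
    |∑ i, v i * (NormedSpace.exp (-(τ • B))).mulVec v i
        - ∑ i, v i * (NormedSpace.exp (-(τ • ((1 / 2 : ℝ) • (B + Bᵀ))))).mulVec v i|
      ≤ ω ^ 2 / 2 * τ ^ 2 * Real.exp (-(b * τ)) * ∑ i, v i ^ 2 := by
  set Bs := (1 / 2 : ℝ) • (B + Bᵀ) with hBs
  set t := τ / 2 with ht_def
  have ht : 0 ≤ t := by positivity
  have hτt : τ = 2 * t := by rw [ht_def]; ring
  set u := (NormedSpace.exp (-(t • B))).mulVec v with hu
  set ub := (NormedSpace.exp (-(t • Bᵀ))).mulVec v with hub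
  set z := (NormedSpace.exp (-(t • Bs))).mulVec v with hz
  set K := Real.sqrt (∑ i, v i ^ 2) with hK
  have hK2 : ∑ i, v i ^ 2 = K ^ 2 := (Real.sq_sqrt (Finset.sum_nonneg fun i _ => sq_nonneg _)).symm
  -- the two forms at time `τ = 2t`
  have hB2 : ∑ i, v i * (NormedSpace.exp (-(τ • B))).mulVec v i = ∑ i, ub i * u i := by
    rw [hτt]; exact form_exp_two_mul_eq B v t
  have hS2 : ∑ i, v i * (NormedSpace.exp (-(τ • Bs))).mulVec v i = ∑ i, z i ^ 2 := by
    rw [dotProduct_exp_neg_smul_mulVec_eq_sum_sq (isSymm_symmPart B) v τ]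
  rw [hB2, hS2]
  -- the split
  have hsplit : ∑ i, ub i * u i - ∑ i, z i ^ 2 = ∑ i, (ub i - z i) * (u i - z i) + ∑ i, z i * (u i + ub i - 2 * z i) := by
    rw [← Finset.sum_sub_distrib, ← Finset.sum_add_distrib]
    exact Finset.sum_congr rfl fun i _ => by ring
  rw [hsplit]
  -- the four norms
  obtain ⟨hd, hdb⟩ := sqrt_sum_sq_orbit_sub_le B v hb hω ht
  have hs := sqrt_sum_sq_orbit_second_le B v hb hω ht
  have hzK := (sqrt_sum_sq_orbit_le B v hb ht).2.2
  have h1 : |∑ i, (ub i - z i) * (u i - z i)| ≤ (Real.exp (-(b * t)) * (|ω| * K * t)) ^ 2 := by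
    rw [abs_le]
    have hcs := sum_mul_le_sqrt_mul_sqrt (fun i => ub i - z i) (fun i => u i - z i)
    have hcs' := sum_mul_le_sqrt_mul_sqrt (fun i => -(ub i - z i)) (fun i => u i - z i)
    have e : ∑ i, (-(ub i - z i)) ^ 2 = ∑ i, (ub i - z i) ^ 2 := Finset.sum_congr rfl fun i _ => by ring
    rw [e] at hcs'
    have e' : ∑ i, -(ub i - z i) * (u i - z i) = -∑ i, (ub i - z i) * (u i - z i) := by
      rw [← Finset.sum_neg_distrib]; exact Finset.sum_congr rfl fun i _ => by ring
    rw [e'] at hcs'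
    have hprod := mul_le_mul hdb hd (Real.sqrt_nonneg _) (by positivity)
    constructor <;> nlinarith
  have h2 : |∑ i, z i * (u i + ub i - 2 * z i)| ≤ (Real.exp (-(b * t)) * K) * (Real.exp (-(b * t)) * (ω ^ 2 * K * t ^ 2)) := by
    rw [abs_le]
    have hcs := sum_mul_le_sqrt_mul_sqrt z (fun i => u i + ub i - 2 * z i)
    have hcs' := sum_mul_le_sqrt_mul_sqrt (fun i => -z i) (fun i => u i + ub i - 2 * z i)
    have e : ∑ i, (-z i) ^ 2 = ∑ i, z i ^ 2 := Finset.sum_congr rfl fun i _ => by ring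
    rw [e] at hcs'
    have e' : ∑ i, -z i * (u i + ub i - 2 * z i) = -∑ i, z i * (u i + ub i - 2 * z i) := by
      rw [← Finset.sum_neg_distrib]; exact Finset.sum_congr rfl fun i _ => by ring
    rw [e'] at hcs'
    have hprod := mul_le_mul hzK hs (Real.sqrt_nonneg _) (by positivity)
    constructor <;> nlinarith
  have hexp : Real.exp (-(b * t)) * Real.exp (-(b * t)) = Real.exp (-(b * τ)) := by
    rw [← Real.exp_add]; congr 1; rw [hτt]; ring
  calc |∑ i, (ub i - z i) * (u i - z i) + ∑ i, z i * (u i + ub i - 2 * z i)|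
      ≤ |∑ i, (ub i - z i) * (u i - z i)| + |∑ i, z i * (u i + ub i - 2 * z i)| := abs_add_le _ _
    _ ≤ (Real.exp (-(b * t)) * (|ω| * K * t)) ^ 2 + (Real.exp (-(b * t)) * K) * (Real.exp (-(b * t)) * (ω ^ 2 * K * t ^ 2)) :=
        add_le_add h1 h2
    _ = 2 * (Real.exp (-(b * t)) * Real.exp (-(b * t))) * ω ^ 2 * K ^ 2 * t ^ 2 := by
        rw [mul_pow, mul_pow, mul_pow, sq_abs]; ring
    _ = ω ^ 2 / 2 * τ ^ 2 * Real.exp (-(b * τ)) * ∑ i, v i ^ 2 := by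
        rw [hexp, hK2, hτt]; ring

end Kernel

end Summit.AnomalousDissipation.AnomalousDissipation.Theorems.SolenoidalFractalHomogenisation.LagrangianStep
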